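import Summits.Ventures.LatticeQCDFlow.Exactness.ReversibleLocalityFloor
import HarnessLib

/-!
# The locality floor with an AVERAGED move bound: `τ_int ≥ 2 C(0)/∫Γw − ½` per step, `≥ 2 C(0)/(V ∫Γw) − ½` per sweep

HONEST FRAMING: exact (Metropolis-corrected) sampling algorithms for lattice gauge theory;
figures of merit are autocorrelation/cost numbers at stated couplings and volumes; no
continuum-physics claim.  (SCALAR calibration rung S0-A: not a gauge result.)

Venture `LatticeQCDFlow` (cell pub-lqcd), topic `Exactness`; FANOUT row 2 (`s0-phi4`).  NEW WORK of
the cell, a one-step sharpening of `Exactness/ReversibleLocalityFloor.lean`: there the carré du champ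
`Γ(x) = K[(g − g(x))²](x)` is bounded POINTWISE (`Γ ≤ D`); here only its AVERAGE `∫ Γ w` enters —
which for a Metropolis-type sampler is `δ² ×` the EQUILIBRIUM ACCEPTANCE RATE times `Z`, not `δ² Z`
(lattice file `Exactness/Phi4MetropolisAcceptanceCSD.lean`).  Nothing is cited as a fact; the
printed per-step counterpart (pointwise bound, finite chains) is Madras–Slade 1993 Cor. 9.2.3, named
only.

## What is proved (namespace `RevOp`; setting of `ReversibleLocalityFloor`)

* `dirichlet_le_of_integral_carre_le` — `∫ Γ w ≤ D ⇒ C(0) − C(1) ≤ D/2`;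
* **`tauInt_ge_of_integral_carre_le`** — `∫ Γ w ≤ D`, summable series, `ρ(1) < 1` ⇒
  `τ_int ≥ 2 C(0)/D − ½`;
* **`thinned_tauInt_ge_of_integral_carre_le`** — per `V ≥ 1` steps: `τ_int^{(V)} ≥ 2 C(0)/(V D) − ½`.

Reading: with `∫ Γ w = δ² ā Z` (window half-width `δ`, equilibrium acceptance rate `ā`) and `g` the
centred magnetisation (`C(0)/Z = Vχ`): `τ_int,sweep ≥ 2χ/(δ² ā) − ½` — the measured acceptance column
enters the certified floor.  NOT CLAIMED: `ρ < 1` / summability for any run (hypotheses).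
-/

namespace Summit.Ventures.LatticeQCDFlow.Exactness

open Real MeasureTheory Filter Finset
open Summit.Ventures.LatticeQCDFlow.Scoring

namespace RevOp

variable {X : Type*} [MeasurableSpace X] {μ : Measure X} {w : X → ℝ} {A : (X → ℝ) → Prop}
  {K : (X → ℝ) → (X → ℝ)}

/-- **Averaged locality bound**: `∫ Γ w ≤ D ⇒ C(0) − C(1) ≤ D/2`. -/
theorem dirichlet_le_of_integral_carre_le (hA1 : A (fun _ => (1 : ℝ)))
    (hAi : ∀ ⦃f h : X → ℝ⦄, A f → A h → Integrable (fun x => f x * h x * w x) μ)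
    (hAc : ∀ ⦃f h : X → ℝ⦄ (c : ℝ), A f → A h → A (fun x => f x + c * h x))
    (hAK : ∀ ⦃f : X → ℝ⦄, A f → A (K f))
    (hlin : ∀ ⦃f h : X → ℝ⦄ (c : ℝ), A f → A h →
      ∀ x, K (fun s => f s + c * h s) x = K f x + c * K h x)
    (hsymm : ∀ ⦃f h : X → ℝ⦄, A f → A h →
      ∫ x, K f x * h x * w x ∂μ = ∫ x, f x * K h x * w x ∂μ)
    (hunit : ∀ x, K (fun _ => (1 : ℝ)) x = 1)
    {g : X → ℝ} (hg : A g) (hg2 : A (fun x => g x ^ 2)) {D : ℝ}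
    (hΓ : ∫ x, K (fun y => (g y - g x) ^ 2) x * w x ∂μ ≤ D) :
    (∫ x, g x ^ 2 * w x ∂μ) - ∫ x, g x * K g x * w x ∂μ ≤ D / 2 := by
  have h2 := two_mul_dirichlet_eq hA1 hAi hAc hAK hlin hsymm hunit hg hg2
  linarith

/-- **THE LOCALITY FLOOR PER STEP, AVERAGED FORM.**  `K` a reversible Markov operator on the class
(with `1 ∈ A`, `K1 = 1`), `g, g² ∈ A`, mean one-step squared displacement `∫ Γ w ≤ D`.  If the
autocorrelation series of `g` is summable and `ρ(1) < 1`, then `τ_int ≥ 2 C(0)/D − ½`. -/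
theorem tauInt_ge_of_integral_carre_le (hw0 : ∀ x, 0 ≤ w x) (hA1 : A (fun _ => (1 : ℝ)))
    (hAi : ∀ ⦃f h : X → ℝ⦄, A f → A h → Integrable (fun x => f x * h x * w x) μ)
    (hAc : ∀ ⦃f h : X → ℝ⦄ (c : ℝ), A f → A h → A (fun x => f x + c * h x))
    (hAK : ∀ ⦃f : X → ℝ⦄, A f → A (K f))
    (hlin : ∀ ⦃f h : X → ℝ⦄ (c : ℝ), A f → A h →
      ∀ x, K (fun s => f s + c * h s) x = K f x + c * K h x)
    (hsymm : ∀ ⦃f h : X → ℝ⦄, A f → A h →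
      ∫ x, K f x * h x * w x ∂μ = ∫ x, f x * K h x * w x ∂μ)
    (hcontr : ∀ ⦃f : X → ℝ⦄, A f → ∫ x, K f x ^ 2 * w x ∂μ ≤ ∫ x, f x ^ 2 * w x ∂μ)
    (hunit : ∀ x, K (fun _ => (1 : ℝ)) x = 1)
    {g : X → ℝ} (hg : A g) (hg2 : A (fun x => g x ^ 2)) {D : ℝ}
    (hΓ : ∫ x, K (fun y => (g y - g x) ^ 2) x * w x ∂μ ≤ D)
    (hs : Summable fun n => (∫ x, g x * (K^[n + 1] g) x * w x ∂μ) / ∫ x, g x ^ 2 * w x ∂μ)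
    (hρ : (∫ x, g x * K g x * w x ∂μ) / (∫ x, g x ^ 2 * w x ∂μ) < 1) :
    2 * (∫ x, g x ^ 2 * w x ∂μ) / D - 1 / 2
      ≤ tauInt (fun n => (∫ x, g x * (K^[n] g) x * w x ∂μ) / ∫ x, g x ^ 2 * w x ∂μ) := by
  have hfloor := tauInt_ge hw0 hAi hAc hAK hlin hsymm hcontr hg hs hρ
  have hdir := dirichlet_le_of_integral_carre_le hA1 hAi hAc hAK hlin hsymm hunit hg hg2 hΓ
  set P := ∫ x, g x ^ 2 * w x ∂μ with hP
  have hP0 : 0 ≤ P := integral_nonneg fun x => mul_nonneg (sq_nonneg _) (hw0 x)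
  rcases eq_or_lt_of_le hP0 with hz | hPpos
  · have ht : tauInt (fun n => (∫ x, g x * (K^[n] g) x * w x ∂μ) / P) = 1 / 2 := by
      simp only [tauInt, ← hz, div_zero, tsum_zero, add_zero]
    rw [ht, ← hz]
    simp only [mul_zero, zero_div]
    norm_num
  · have h1 : 1 - (∫ x, g x * K g x * w x ∂μ) / P ≤ D / (2 * P) * (1 - 0) := by
      rw [sub_zero, mul_one]
      have e : 1 - (∫ x, g x * K g x * w x ∂μ) / P = (P - ∫ x, g x * K g x * w x ∂μ) / P := by
        field_simp
      rw [e, div_le_div_iff₀ hPpos (by positivity)]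
      nlinarith [hdir, hPpos]
    have ht := floor_transfer hρ h1
    have e2 : 1 / (D / (2 * P) * (1 - (0 : ℝ))) = 2 * P / D := by
      rw [sub_zero, mul_one, one_div_div]
    rw [e2] at ht
    exact ht.trans hfloor

/-- **THE LOCALITY FLOOR PER SWEEP, AVERAGED FORM.**  Same setting, the chain observed every `V ≥ 1`
steps: if the thinned series is summable and `ρ(V) < 1`, then `τ_int^{(V)} ≥ 2 C(0)/(V D) − ½`. -/
theorem thinned_tauInt_ge_of_integral_carre_le (hw0 : ∀ x, 0 ≤ w x) (hA1 : A (fun _ => (1 : ℝ)))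
    (hAi : ∀ ⦃f h : X → ℝ⦄, A f → A h → Integrable (fun x => f x * h x * w x) μ)
    (hAc : ∀ ⦃f h : X → ℝ⦄ (c : ℝ), A f → A h → A (fun x => f x + c * h x))
    (hAK : ∀ ⦃f : X → ℝ⦄, A f → A (K f))
    (hlin : ∀ ⦃f h : X → ℝ⦄ (c : ℝ), A f → A h →
      ∀ x, K (fun s => f s + c * h s) x = K f x + c * K h x)
    (hsymm : ∀ ⦃f h : X → ℝ⦄, A f → A h →
      ∫ x, K f x * h x * w x ∂μ = ∫ x, f x * K h x * w x ∂μ)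
    (hcontr : ∀ ⦃f : X → ℝ⦄, A f → ∫ x, K f x ^ 2 * w x ∂μ ≤ ∫ x, f x ^ 2 * w x ∂μ)
    (hunit : ∀ x, K (fun _ => (1 : ℝ)) x = 1)
    {g : X → ℝ} (hg : A g) (hg2 : A (fun x => g x ^ 2)) {D : ℝ}
    (hΓ : ∫ x, K (fun y => (g y - g x) ^ 2) x * w x ∂μ ≤ D) {V : ℕ} (hV : 0 < V)
    (hs : Summable fun n => (∫ x, g x * (K^[V * (n + 1)] g) x * w x ∂μ) / ∫ x, g x ^ 2 * w x ∂μ)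
    (hρV : (∫ x, g x * (K^[V] g) x * w x ∂μ) / (∫ x, g x ^ 2 * w x ∂μ) < 1) :
    2 * (∫ x, g x ^ 2 * w x ∂μ) / (V * D) - 1 / 2
      ≤ tauInt (fun n => (∫ x, g x * (K^[V * n] g) x * w x ∂μ) / ∫ x, g x ^ 2 * w x ∂μ) := by
  have hfloor := thinned_tauInt_ge hw0 hAi hAc hAK hlin hsymm hcontr hg hV hs hρV
  have hdir := dirichlet_le_of_integral_carre_le hA1 hAi hAc hAK hlin hsymm hunit hg hg2 hΓ
  set P := ∫ x, g x ^ 2 * w x ∂μ with hP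
  have hP0 : 0 ≤ P := integral_nonneg fun x => mul_nonneg (sq_nonneg _) (hw0 x)
  have hVpos : (0 : ℝ) < V := by exact_mod_cast hV
  refine le_trans ?_ hfloor
  rcases eq_or_lt_of_le hP0 with hz | hPpos
  · rw [← hz]
    simp only [mul_zero, zero_div, div_zero, sub_zero, mul_one]
    have : 0 ≤ 1 / (V : ℝ) := by positivity
    linarith
  · have hy : 0 < 1 - (∫ x, g x * K g x * w x ∂μ) / P := by
      have h := one_sub_autocorr_le hw0 hAi hAc hAK hlin hsymm hcontr hg hPpos V
      have hx : 0 < 1 - (∫ x, g x * (K^[V] g) x * w x ∂μ) / P := by linarith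
      exact (mul_pos_iff_of_pos_left hVpos).mp (lt_of_lt_of_le hx h)
    have h1 : 1 - (∫ x, g x * K g x * w x ∂μ) / P ≤ D / (2 * P) := by
      have e : 1 - (∫ x, g x * K g x * w x ∂μ) / P = (P - ∫ x, g x * K g x * w x ∂μ) / P := by
        field_simp
      rw [e, div_le_div_iff₀ hPpos (by positivity)]
      nlinarith [hdir, hPpos]
    have h2 : (V : ℝ) * (1 - (∫ x, g x * K g x * w x ∂μ) / P) ≤ V * D / (2 * P) := by
      have := mul_le_mul_of_nonneg_left h1 hVpos.le
      calc (V : ℝ) * (1 - (∫ x, g x * K g x * w x ∂μ) / P) ≤ V * (D / (2 * P)) := this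
        _ = V * D / (2 * P) := by ring
    have h3 := one_div_le_one_div_of_le (mul_pos hVpos hy) h2
    have e3 : 1 / ((V : ℝ) * D / (2 * P)) = 2 * P / (V * D) := by
      rw [one_div_div]
    rw [e3] at h3
    linarith

end RevOp

end Summit.Ventures.LatticeQCDFlow.Exactness
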